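import Summits.BirchSwinnertonDyer.Rank1Residual.Iwasawa.RankGrowthRouteC
import Literature.NumberTheory.EllipticCurves.IwasawaOrderOfVanishing
import HarnessLib

/-!
# Route C with multiplicity `t` ("C^t") and the END-TO-END implication
# rank-growth certificate ⇒ Mazur's main conjecture at a reducible good ordinary `p`
# (cell `b2b-bsdres`; iw-1's sketch `RankGrowthRouteC.lean` §6 / `CyclotomicFactorPow.lean`, filed by
# prover unit `b2b-bsdres-additive-p3`, gen 15, with the p. 132 shape DISCHARGED)

HONEST FRAMING (run/shared/lean/b2b/bsd-rank1-residual/, verbatim in every file): the goal of the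
cell is to DELETE the COMBINATION-SHAPED residual classes of the Birch–Swinnerton-Dyer formula for
ALL analytic-rank `≤ 1` elliptic curves over `ℚ` — "full BSD formula for every rank `≤ 1` curve in
class `C`" assembled STRICTLY from published theorems — so that the rank-`≤ 1` remainder becomes
exactly the CONSTRUCTION-SHAPED classes, which are TYPED (missing-input `Prop`s), NOT attempted.
This is not "finishing BSD". Sub-cell of eisenstein-p1's class X1 ∩ {r = 0} (research route; NO
CLAIM BEYOND STATED CLASSES); one TYPED per-pair input (`CyclotomicFactorPowAt`, the tree's
`CyclotomicFactorAt` with multiplicity) and theorems over PUBLISHED named facts (hW16 = Wuthrich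
2014 Thm 16, hGr = Greenberg Thm 4.1, h310 = Greenberg Prop 3.10, all already hypotheses of
eisenstein-p1's `X1/CyclotomicZeros.lean`) and the cell's typed per-pair inputs; nothing about any
particular curve is asserted; nothing booked; no label changes.

* `CyclotomicFactorPowAt W p t` (TYPED): `ξ_p^t ∣ f_E`; `t = 1` is the tree's `CyclotomicFactorAt`.
* `lam_eq_of_xi_pow_dvd`: `f = ξ_p^t g ≠ 0 ⇒ λ(f) = t(p−1) + λ(g)`, `μ(f) = μ(g)`, `f(0) = p^t g(0)`.
* `mazurMainConjecture_of_cyclotomicFactorPowTorsion_of_hb` — eisenstein-p1's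
  `mazurMainConjecture_of_cyclotomicFactor_of_hb2` with `ξ ↦ ξ^t` (iw-1 GEN 9): `μ_an ≤ m`, μ-part,
  `λ_an = n ≤ t(p−1) + 2`, `ξ_p^t ∣ f_E` (torsion-guarded), hb(t) :
  `m + t + 1 + 2·v_p #E(ℚ)_tors ≤ v_p ∏c_ℓ + 2·v_p #Ẽ(𝔽_p)`, `L(E,1) ≠ 0` ⇒ Mazur's main conjecture;
  unguarded and `t = 1` corollaries.
* **`mazurMainConjecture_of_layerRankGEAt_pow`** — END TO END, and (gen 15) WITHOUT the p. 132 shape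
  hypothesis: certificate `Iwasawa.LayerRankGEAt W p 1 ((p−1)·t)` (`rank E(ℚ_1) ≥ (p−1)t`) + the
  published hW16/hGr/h310 + per-pair `AnalyticMuLE m`, `MuPartAt`, `AnalyticLambdaEq n`, hb(t),
  `n ≤ t(p−1)+2`, `L(E,1) ≠ 0` ⇒ `MazurMainConjecture W p`; `rank E(ℚ) = 0` is read off inside from
  `f_E(0) ≠ 0` (`X_pow_mordellWeilRank_dvd_of_mem_charIdeal`, BMS Thm 1.7 / LNM Lemma 3.1), and
  `ξ_p^t ∣ f_E` comes from the certificate by the THEOREM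
  `Iwasawa.cyclotomicFactorPowAtTorsion_of_layerRankGEAt` (Greenberg p. 132 made a theorem,
  `Iwasawa/RankGrowthCyclotomicFactor.lean`). Instances (owners' numbers, owners' booking — iw-1
  FILING.md §3): 14534b1@3 (t 1, m 0, n 4), 12194d2@3 (t 1, m 1, n 4), 11170d1@3 (t 2, m 0, n 6).

References: [GreenbergLNM1716] Thm. 1.2, Lemma 3.1, Prop. 3.10, Thm. 4.1 (p. 102), §5 p. 132;
[Wuthrich2014] Thm. 16 (p. 397); [BalakrishnanMullerStein2015] Thm. 1.7.
-/

noncomputable section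

open scoped Classical MatrixGroups ModularForm

open CongruenceSubgroup WeierstrassCurve Literature.NumberTheory.EllipticCurves
  Literature.NumberTheory.EllipticCurves.ModularForms
  Literature.NumberTheory.EllipticCurves.Rank1Residual
  Literature.NumberTheory.EllipticCurves.Rank1Residual.Typed
  Literature.NumberTheory.EllipticCurves.Wuthrich2014
  Literature.NumberTheory.EllipticCurves.GreenbergVatsal2000
  Summit.BirchSwinnertonDyer.Rank1Residual.X1.MuLambda
  Summit.BirchSwinnertonDyer.Rank1Residual.X1.ParitySqueeze
  Summit.BirchSwinnertonDyer.Rank1Residual.X11a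

set_option autoImplicit false

namespace Summit.BirchSwinnertonDyer.Rank1Residual.X1.CyclotomicFactorPow

open PowerSeries Literature.NumberTheory.EllipticCurves.Greenberg1999
  Summit.BirchSwinnertonDyer.BirchSwinnertonDyer.Theorems.Rank1ResidualX1Defs
  Summit.BirchSwinnertonDyer.Rank1Residual.X1.MuPart
  Summit.BirchSwinnertonDyer.Rank1Residual.X1.CyclotomicZeros

/-- **Typed shape: `ξ_p^t` divides `f_E`** (the tree's `CyclotomicFactorAt` with multiplicity `t`;
a `Prop`, nothing asserted; certificate = `t` `ℤ[Gal(ℚ_1/ℚ)]`-independent points of `E(ℚ_1)` modulo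
`E(ℚ)`, i.e. `rank E(ℚ_1) ≥ rank E(ℚ) + t(p−1)`). [cite: GreenbergLNM1716, §5 p. 132 ("θ₁^t divides f_E(T)"; shape only, nothing asserted)] -/
def CyclotomicFactorPowAt (W : WeierstrassCurve ℚ) [W.IsElliptic] [W.IsGloballyMinimal] (p : ℕ)
    [Fact p.Prime] (t : ℕ) : Prop :=
  ∀ (κ : ZpExtension ℚ p) (γ : Field.absoluteGaloisGroup ℚ),
      κ.IsCyclotomic → κ.IsTopGenerator γ → IsCyclotomicVariable p γ →
    ∀ (D : W.SelmerDualData κ γ) (fE : IwasawaAlgebra p), D.charIdeal = Ideal.span {fE} →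
      CyclotomicZeros.xi p ^ t ∣ fE

section Squeeze

variable {W : WeierstrassCurve ℚ} [W.IsElliptic] [W.IsGloballyMinimal] {p : ℕ} [Fact p.Prime]

/-- `t = 1` is the tree's shape. -/
theorem cyclotomicFactorPowAt_one_iff : CyclotomicFactorPowAt W p 1 ↔ CyclotomicFactorAt W p := by
  simp only [CyclotomicFactorPowAt, CyclotomicFactorAt, pow_one]

/-- unguarded ⇒ guarded. -/
theorem cyclotomicFactorPowAtTorsion_of_cyclotomicFactorPowAt {t : ℕ}
    (h : CyclotomicFactorPowAt W p t) : Iwasawa.CyclotomicFactorPowAtTorsion W p t :=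
  fun κ γ hκ hγ hγ' D _ _ fE hfE ↦ h κ γ hκ hγ hγ' D fE hfE

/-- `f = ξ_p^t · g ≠ 0` ⇒ `λ(f) = t(p − 1) + λ(g)`, `μ(f) = μ(g)`, `f(0) = p^t · g(0)`. [folklore] -/
theorem lam_eq_of_xi_pow_dvd {f g : IwasawaAlgebra p} (t : ℕ) (hf : f ≠ 0) (hfac : f = xi p ^ t * g) :
    g ≠ 0 ∧ lam f = t * (p - 1) + lam g ∧ mu f = mu g ∧
      constantCoeff f = (p : ℤ_[p]) ^ t * constantCoeff g := by
  induction t generalizing f g with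
  | zero =>
    rw [pow_zero, one_mul] at hfac
    subst hfac
    exact ⟨hf, by simp, rfl, by simp⟩
  | succ t ih =>
    rw [pow_succ, mul_assoc] at hfac
    obtain ⟨hxg, hlam1, hmu1, hc1⟩ := ih hf hfac
    obtain ⟨hg, hlam2, hmu2, hc2⟩ := lam_eq_of_xi_dvd hxg rfl
    refine ⟨hg, ?_, hmu1.trans hmu2, ?_⟩
    · rw [hlam1, hlam2, Nat.add_mul, one_mul]; omega
    · rw [hc1, hc2, pow_succ]; ring

/-- **Route C with multiplicity ("C^t"): `μ_an ≤ m ∧ μ-part ∧ λ_an = n ≤ t(p−1) + 2 ∧ ξ_p^t ∣ f_E ∧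
`m + t + 1 + 2·ord_p #E(ℚ)_tors ≤ ord_p ∏c_ℓ + 2·ord_p #Ẽ(𝔽_p)` ⇒ Mazur's main conjecture** at a good
ordinary `p ≠ 2` with `E[p]` reducible and `L(E,1) ≠ 0`. Proof = eisenstein-p1's
`mazurMainConjecture_of_cyclotomicFactor_of_hb2` with `ξ ↦ ξ^t`: `f_E = ξ^t·q`; if `λ(q) = 0` then
`ord_p f_E(0) = t + μ(f_E) ≤ t + m`, contradicting Thm. 4.1 (`hGr`) and hb(t); so `λ(f_E) ≥ t(p−1)+1`,
hence (Prop. 3.10 parity at corank `0`, `h310`; `t(p−1)` even) `≥ t(p−1) + 2 ≥ n`, and `h ∈ Λˣ`.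
[cite: GreenbergLNM1716, Thm. 1.2, Prop. 3.10, Thm. 4.1 (p. 102) and §5 p. 132]
[cite: Wuthrich2014, Thm. 16 (p. 397)] -/
theorem mazurMainConjecture_of_cyclotomicFactorPowTorsion_of_hb
    (hW16 : Wuthrich2014.charIdeal_dvd_padicLFunction) (hGr : greenberg_charValue_rankZero)
    (h310 : prop310_selmerCorank_mod_two_eq_lambdaInvariant)
    (hp : p ≠ 2) (hgood : W.HasGoodReductionAtPrime p) (hord : ¬ (p : ℤ) ∣ W.frobeniusTrace p)
    (hred : ¬ W.HasIrreducibleModPGaloisRep p) (hL : W.entireLFunction 1 ≠ 0)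
    {m : ℕ} (hμan : AnalyticMuLE W p m) (hμ : MuLambda.MuPartAt W p) {n : ℕ}
    (hlam : AnalyticLambdaEq W p n) {t : ℕ} (hξ : Iwasawa.CyclotomicFactorPowAtTorsion W p t)
    (hb : m + t + 1 + 2 * padicValNat p W.torsionOrder ≤
      padicValNat p W.tamagawaProduct + 2 * padicValNat p (W.reductionPointCount p))
    (hn : n ≤ t * (p - 1) + 2) : MazurMainConjecture W p := by
  intro κ γ hκ hγ hγ' _ f hf ϖ hϖ D
  have hpP : p.Prime := Fact.out
  have hordp : IsOrdinaryAt W p := ⟨hgood, hord⟩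
  haveI : Module.Finite (IwasawaAlgebra p) D.X := D.module_finite_holds hγ
  -- Wuthrich Thm. 16: `X` torsion, `ι g = ϖ · L_p(f, α)` with `g ∈ char X = (fE)`, `g = fE · h`
  obtain ⟨hX, g, hgmem, hιg⟩ := hW16 W p hp hordp hred hκ hγ hγ' hf D ϖ hϖ
  obtain ⟨fE, hchar⟩ := (charIdeal_isPrincipal_holds p D.X).principal
  have hchar' : D.charIdeal = Ideal.span {fE} := hchar
  have hgmem' : g ∈ Ideal.span {fE} := by rw [← hchar']; exact hgmem
  obtain ⟨h, hgh⟩ := Ideal.mem_span_singleton'.mp hgmem'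
  have hfac : fE * h = g := by rw [mul_comm]; exact hgh
  have hιg' : iwasawaToPowerSeries p (fE * h) =
      C (ϖ : ℚ_[p]) * padicLFunction f (unitRoot W p : ℚ_[p]) := by rw [hfac, hιg]
  have hg0 : fE * h ≠ 0 := mul_ne_zero_of_iota_eq hgood hord hf hϖ D hιg'
  have hfE0 : fE ≠ 0 := fun h0 ↦ hg0 (by rw [h0, zero_mul])
  have hh0 : h ≠ 0 := fun h0 ↦ hg0 (by rw [h0, mul_zero])
  -- the cyclotomic factor with multiplicity: `fE = ξ^t · q`
  obtain ⟨q, hq⟩ := hξ κ γ hκ hγ hγ' D hX fE hchar'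
  obtain ⟨hq0, hlamfE, hmufE, hconst⟩ := lam_eq_of_xi_pow_dvd t hfE0 hq
  -- certificates: μ-part, `μ_an ≤ m`, `λ_an = n`
  have hμ' : mu (fE * h) ≤ mu fE := hμ κ γ hκ hγ hγ' f hf ϖ hϖ D fE h hchar' hιg'
  have hμm : mu (fE * h) ≤ m := by
    obtain ⟨k, hk⟩ := hμan f hf ϖ hϖ
    rw [← hιg'] at hk
    exact mu_le_of_lt_norm_coeff hk
  have hlam' : lam (fE * h) = n := hlam f hf ϖ hϖ (fE * h) hιg'
  have hμfE : mu fE ≤ m := (mu_le_mu_mul hfE0 hh0).trans hμm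
  -- `fE(0) ≠ 0` from `L(E,1) ≠ 0`
  set a : ℚ_[p] := ((unitRoot W p : ℤ_[p]) : ℚ_[p]) with ha
  set s : ℚ := ratPlusSymbol f 0 with hs_def
  have hs0 : s ≠ 0 := by
    intro h0
    apply hL
    rw [hf.entireLFunction_one_eq, ← hs_def, h0]
    simp
  have hϖ0 : ϖ ≠ 0 := ParitySqueeze.varpi_ne_zero hf hϖ
  have hg0c : ((constantCoeff g : ℤ_[p]) : ℚ_[p]) = (ϖ : ℚ_[p]) * ((1 - a⁻¹) ^ 2 * (s : ℚ_[p])) := by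
    rw [← constantCoeff_iwasawaToPowerSeries p g, hιg, map_mul, constantCoeff_C,
      constantCoeff_padicLFunction_unitRoot hordp hf]
  obtain ⟨u₂, hu₂⟩ := exists_unit_one_sub_unitRoot_inv p W hordp
  haveI : NeZero p := ⟨hpP.ne_zero⟩
  obtain ⟨u₃, hu₃⟩ := exists_unit_natCard_eq_mul_card_primaryComponent
    ((integralModelInt W).map (Int.castRingHom (ZMod p))).toAffine.Point p
  set Np : ℚ_[p] := (Nat.card (AddCommGroup.primaryComponent
    ((integralModelInt W).map (Int.castRingHom (ZMod p))).toAffine.Point p) : ℚ_[p]) with hNp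
  have hNcount : (W.reductionPointCount p : ℚ_[p]) = ((u₃ : ℤ_[p]) : ℚ_[p]) * Np := by
    rw [WeierstrassCurve.reductionPointCount, hNp]
    exact hu₃
  have hNp0 : Np ≠ 0 := by rw [hNp]; exact_mod_cast Nat.card_pos.ne'
  have h1 : (1 - a⁻¹) = ((u₂ : ℤ_[p]) : ℚ_[p]) * ((u₃ : ℤ_[p]) : ℚ_[p]) * Np := by
    rw [hu₂, hNcount, mul_assoc]
  have h1ne : (1 - a⁻¹) ≠ 0 := by
    rw [h1]
    exact mul_ne_zero (mul_ne_zero (coe_units_ne_zero p u₂) (coe_units_ne_zero p u₃)) hNp0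
  have hg00 : constantCoeff g ≠ 0 := by
    intro h0
    rw [h0, PadicInt.coe_zero] at hg0c
    have : (ϖ : ℚ_[p]) * ((1 - a⁻¹) ^ 2 * (s : ℚ_[p])) ≠ 0 :=
      mul_ne_zero (by exact_mod_cast hϖ0) (mul_ne_zero (pow_ne_zero 2 h1ne) (by exact_mod_cast hs0))
    exact this hg0c.symm
  have hfE00 : constantCoeff fE ≠ 0 := by
    intro h0
    apply hg00
    rw [← hgh, map_mul, h0, mul_zero]
  -- `Sel_{p^∞}(E/ℚ)` finite ⇒ `corank = 0` ⇒ `λ(fE)` even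
  have hSelfin : Finite (W.selmerGroupPInfty p) :=
    D.finite_selmerGroupPInfty_of_constantCoeff_ne_zero W hγ hX fE hchar' hfE00
  obtain ⟨hEfin, -⟩ := (W.finite_selmerGroupPInfty_iff p).mp hSelfin
  haveI := hEfin
  have hcork : W.selmerCorank p = 0 := by
    haveI := hSelfin
    exact zpCorank_eq_zero_of_finite (W.selmerGroupPInfty p) p
  have heven : Even (lam fE) := by
    rw [ParitySqueeze.lam_generator_eq_lambdaInvariant D.X hX hfE0 hchar']
    exact prop310_selmerCorank_mod_two_eq_lambdaInvariant.even_lambdaInvariant_of_selmerCorank_eq_zero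
      h310 W p hp hκ hγ D hX hcork
  -- `λ(q) ≠ 0`: otherwise `ord_p fE(0) = 1 + μ(fE) ≤ 1 + m`, contradicting Thm. 4.1 and `hb2`
  have hqne : lam q ≠ 0 := by
    intro hq00
    obtain ⟨hqc0, hqval⟩ := ParitySqueeze.valuation_constantCoeff_of_lam_eq_zero hq0 hq00
    -- Greenberg Thm. 4.1 for the generator `fE`
    obtain ⟨u₁, hu₁⟩ := hGr W p hp hgood hord κ γ hκ hγ hγ' D hX fE hchar' hSelfin
    obtain ⟨u₄, hu₄⟩ := exists_unit_torsionOrder_eq W p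
    set v := padicValNat p W.tamagawaProduct with hv
    set Tp : ℚ_[p] := (Nat.card (AddCommGroup.primaryComponent W.toAffine.Point p) : ℚ_[p]) with hTp
    set f0 : ℚ_[p] := ((constantCoeff fE : ℤ_[p]) : ℚ_[p]) with hf0
    have hf0ne : f0 ≠ 0 := by
      rw [hf0]
      intro h0'
      exact hfE00 (by exact_mod_cast (PadicInt.coe_eq_zero.mp h0'))
    have hTp0 : Tp ≠ 0 := by rw [hTp]; exact_mod_cast Nat.card_pos.ne'
    have hp0 : (p : ℚ_[p]) ≠ 0 := Nat.cast_ne_zero.mpr hpP.ne_zero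
    have hSel0 : (Nat.card (W.selmerGroupPInfty p) : ℚ_[p]) ≠ 0 := by
      haveI := hSelfin
      exact_mod_cast Nat.card_pos.ne'
    have hu₄' : (W.torsionOrder : ℚ_[p]) = ((u₄ : ℤ_[p]) : ℚ_[p]) * Tp := by
      rw [hu₄, hTp]
      congr 1
      exact_mod_cast natCard_primaryComponent_point_congr W p _ _
    have hval1 := congrArg Padic.valuation hu₁
    rw [Padic.valuation_mul hf0ne (pow_ne_zero 2 hTp0), Padic.valuation_pow,
      Padic.valuation_mul (mul_ne_zero (mul_ne_zero (coe_units_ne_zero p u₁) (pow_ne_zero v hp0))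
        (pow_ne_zero 2 hNp0)) hSel0,
      Padic.valuation_mul (mul_ne_zero (coe_units_ne_zero p u₁) (pow_ne_zero v hp0))
        (pow_ne_zero 2 hNp0),
      Padic.valuation_mul (coe_units_ne_zero p u₁) (pow_ne_zero v hp0), valuation_coe_units_eq_zero,
      Padic.valuation_pow, Padic.valuation_pow, Padic.valuation_p] at hval1
    have hvT : Tp.valuation = (padicValNat p W.torsionOrder : ℤ) := by
      have e := congrArg Padic.valuation hu₄'
      rw [Padic.valuation_natCast, Padic.valuation_mul (coe_units_ne_zero p u₄) hTp0,
        valuation_coe_units_eq_zero, zero_add] at e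
      exact e.symm
    have hvN : Np.valuation = (padicValNat p (W.reductionPointCount p) : ℤ) := by
      have e := congrArg Padic.valuation hNcount
      rw [Padic.valuation_natCast, Padic.valuation_mul (coe_units_ne_zero p u₃) hNp0,
        valuation_coe_units_eq_zero, zero_add] at e
      exact e.symm
    rw [hvT, hvN] at hval1
    -- `v(f0) = t + μ(fE)`: `fE(0) = p^t · q(0)` and `v(q(0)) = μ(q) = μ(fE)`
    have hqc : ((constantCoeff q : ℤ_[p]) : ℚ_[p]) ≠ 0 := hqc0
    have hpt0 : (p : ℚ_[p]) ^ t ≠ 0 := pow_ne_zero t hp0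
    have hval' : f0.valuation = t + (mu fE : ℤ) := by
      rw [hf0, hconst, PadicInt.coe_mul, PadicInt.coe_pow, PadicInt.coe_natCast,
        Padic.valuation_mul hpt0 hqc, Padic.valuation_pow, Padic.valuation_p, hqval, hmufE]
      ring
    rw [hval'] at hval1
    have hSelv : 0 ≤ (Nat.card (W.selmerGroupPInfty p) : ℚ_[p]).valuation := by
      rw [Padic.valuation_natCast]; exact_mod_cast Nat.zero_le _
    simp only [Nat.cast_ofNat] at hval1
    have hb' : (m : ℤ) + t + 1 + 2 * (padicValNat p W.torsionOrder : ℤ) ≤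
        (padicValNat p W.tamagawaProduct : ℤ) + 2 * (padicValNat p (W.reductionPointCount p) : ℤ) := by
      exact_mod_cast hb
    have hμfE' : (mu fE : ℤ) ≤ m := by exact_mod_cast hμfE
    linarith
  -- the squeeze: `λ(fE) ≥ t(p−1) + 1`, even, `t(p−1)` even, so `≥ t(p−1) + 2 ≥ n = λ(fE) + λ(h)`
  have hoddp : Odd p := hpP.odd_of_ne_two hp
  have hevs : Even (t * (p - 1)) := (Nat.Odd.sub_odd hoddp odd_one).mul_left t
  have hunit : IsUnit h := by
    rw [isUnit_iff_mu_eq_zero_and_lam_eq_zero]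
    rw [mu_mul hfE0 hh0] at hμ'
    rw [lam_mul hfE0 hh0] at hlam'
    obtain ⟨k, hk⟩ := heven
    obtain ⟨k₂, hk₂⟩ := hevs
    have hq1 : 1 ≤ lam q := Nat.one_le_iff_ne_zero.mpr hqne
    generalize hs : t * (p - 1) = s at hlamfE hn hk₂
    refine ⟨hh0, by omega, by omega⟩
  refine ⟨hX, g, ?_, hιg⟩
  rw [hchar', ← hfac]
  exact ((span_eq_span_iff_isUnit hfE0 rfl).mpr hunit).symm

/-- The same with the UNGUARDED shape `CyclotomicFactorPowAt` (the tree's convention). -/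
theorem mazurMainConjecture_of_cyclotomicFactorPow_of_hb
    (hW16 : Wuthrich2014.charIdeal_dvd_padicLFunction) (hGr : greenberg_charValue_rankZero)
    (h310 : prop310_selmerCorank_mod_two_eq_lambdaInvariant)
    (hp : p ≠ 2) (hgood : W.HasGoodReductionAtPrime p) (hord : ¬ (p : ℤ) ∣ W.frobeniusTrace p)
    (hred : ¬ W.HasIrreducibleModPGaloisRep p) (hL : W.entireLFunction 1 ≠ 0)
    {m : ℕ} (hμan : AnalyticMuLE W p m) (hμ : MuLambda.MuPartAt W p) {n : ℕ}
    (hlam : AnalyticLambdaEq W p n) {t : ℕ} (hξ : CyclotomicFactorPowAt W p t)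
    (hb : m + t + 1 + 2 * padicValNat p W.torsionOrder ≤
      padicValNat p W.tamagawaProduct + 2 * padicValNat p (W.reductionPointCount p))
    (hn : n ≤ t * (p - 1) + 2) : MazurMainConjecture W p :=
  mazurMainConjecture_of_cyclotomicFactorPowTorsion_of_hb hW16 hGr h310 hp hgood hord hred hL hμan hμ
    hlam (cyclotomicFactorPowAtTorsion_of_cyclotomicFactorPowAt hξ) hb hn

/-- And at `t = 1` with the tree's `CyclotomicFactorAt`: eisenstein-p1's route C is the case `t = 1`
(`n ≤ p + 1`, hb2). -/
theorem mazurMainConjecture_of_cyclotomicFactor_of_hb2'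
    (hW16 : Wuthrich2014.charIdeal_dvd_padicLFunction) (hGr : greenberg_charValue_rankZero)
    (h310 : prop310_selmerCorank_mod_two_eq_lambdaInvariant)
    (hp : p ≠ 2) (hgood : W.HasGoodReductionAtPrime p) (hord : ¬ (p : ℤ) ∣ W.frobeniusTrace p)
    (hred : ¬ W.HasIrreducibleModPGaloisRep p) (hL : W.entireLFunction 1 ≠ 0)
    {m : ℕ} (hμan : AnalyticMuLE W p m) (hμ : MuLambda.MuPartAt W p) {n : ℕ}
    (hlam : AnalyticLambdaEq W p n) (hξ : CyclotomicFactorAt W p)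
    (hb2 : m + 2 + 2 * padicValNat p W.torsionOrder ≤
      padicValNat p W.tamagawaProduct + 2 * padicValNat p (W.reductionPointCount p))
    (hn : n ≤ p + 1) : MazurMainConjecture W p := by
  have hpP : p.Prime := Fact.out
  refine mazurMainConjecture_of_cyclotomicFactorPow_of_hb hW16 hGr h310 hp hgood hord hred hL hμan hμ
    hlam (t := 1) (cyclotomicFactorPowAt_one_iff.mpr hξ) (by omega) ?_
  have : 1 * (p - 1) + 2 = p + 1 := by have := hpP.one_le; omega
  omega

/-- **END TO END at a double (or `t`-fold) cyclotomic zero, reducible good ordinary `p`, `L(E,1) ≠ 0`: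
rank-growth certificate ⇒ Mazur's main conjecture**, modulo ONLY the PUBLISHED facts hW16 / hGr / h310
(as in eisenstein-p1's route C; the Γ-equivariant p. 132 step is now the tree theorem
`Iwasawa.cyclotomicFactorPowAtTorsion_of_layerRankGEAt`, gen 15). Inputs per pair: `LayerRankGEAt W p 1 ((p−1)t)` (the certificate:
`rank E(ℚ_1) ≥ (p−1)t`; at `p = 3`, `t = 2` the `certified-rank-plus-4` datum), `AnalyticMuLE m`,
`MuPartAt`, `AnalyticLambdaEq n`, hb(t), `n ≤ t(p−1) + 2`. `rank E(ℚ) = 0` is NOT an input: it is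
read off inside the proof from `f_E(0) ≠ 0` (BMS Thm. 1.7 / LNM 1716 Lemma 3.1: `T^{rank E(ℚ)} ∣ f_E`,
tree theorem `X_pow_mordellWeilRank_dvd_of_mem_charIdeal`). Instance: `11170d1@3` (t = 2, m = 0,
n = 6, hb(2): 5 ≤ 5). [cite: GreenbergLNM1716, Thm. 1.2, Lemma 3.1, Prop. 3.10, Thm. 4.1 and §5 p. 132]
[cite: Wuthrich2014, Thm. 16 (p. 397)] [cite: BalakrishnanMullerStein2015, Thm. 1.7] -/
theorem mazurMainConjecture_of_layerRankGEAt_pow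
    (hW16 : Wuthrich2014.charIdeal_dvd_padicLFunction) (hGr : greenberg_charValue_rankZero)
    (h310 : prop310_selmerCorank_mod_two_eq_lambdaInvariant)
    (hp : p ≠ 2) (hgood : W.HasGoodReductionAtPrime p) (hord : ¬ (p : ℤ) ∣ W.frobeniusTrace p)
    (hred : ¬ W.HasIrreducibleModPGaloisRep p) (hL : W.entireLFunction 1 ≠ 0)
    {m : ℕ} (hμan : AnalyticMuLE W p m) (hμ : MuLambda.MuPartAt W p) {n : ℕ}
    (hlam : AnalyticLambdaEq W p n) {t : ℕ} (hm : Iwasawa.LayerRankGEAt W p 1 ((p - 1) * t))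
    (hb : m + t + 1 + 2 * padicValNat p W.torsionOrder ≤
      padicValNat p W.tamagawaProduct + 2 * padicValNat p (W.reductionPointCount p))
    (hn : n ≤ t * (p - 1) + 2) : MazurMainConjecture W p := by
  intro κ γ hκ hγ hγ' h₆ f hf ϖ hϖ D
  have hpP : p.Prime := Fact.out
  have hordp : IsOrdinaryAt W p := ⟨hgood, hord⟩
  haveI : Module.Finite (IwasawaAlgebra p) D.X := D.module_finite_holds hγ
  obtain ⟨hX, g, hgmem, hιg⟩ := hW16 W p hp hordp hred hκ hγ hγ' hf D ϖ hϖ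
  obtain ⟨fE, hchar⟩ := (charIdeal_isPrincipal_holds p D.X).principal
  have hchar' : D.charIdeal = Ideal.span {fE} := hchar
  have hgmem' : g ∈ Ideal.span {fE} := by rw [← hchar']; exact hgmem
  obtain ⟨h, hgh⟩ := Ideal.mem_span_singleton'.mp hgmem'
  -- `fE(0) ≠ 0` from `L(E,1) ≠ 0` (as in route C)
  set a : ℚ_[p] := ((unitRoot W p : ℤ_[p]) : ℚ_[p]) with ha
  set s : ℚ := ratPlusSymbol f 0 with hs_def
  have hs0 : s ≠ 0 := by
    intro h0
    apply hL
    rw [hf.entireLFunction_one_eq, ← hs_def, h0]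
    simp
  have hϖ0 : ϖ ≠ 0 := ParitySqueeze.varpi_ne_zero hf hϖ
  have hg0c : ((constantCoeff g : ℤ_[p]) : ℚ_[p]) = (ϖ : ℚ_[p]) * ((1 - a⁻¹) ^ 2 * (s : ℚ_[p])) := by
    rw [← constantCoeff_iwasawaToPowerSeries p g, hιg, map_mul, constantCoeff_C,
      constantCoeff_padicLFunction_unitRoot hordp hf]
  obtain ⟨u₂, hu₂⟩ := exists_unit_one_sub_unitRoot_inv p W hordp
  haveI : NeZero p := ⟨hpP.ne_zero⟩
  obtain ⟨u₃, hu₃⟩ := exists_unit_natCard_eq_mul_card_primaryComponent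
    ((integralModelInt W).map (Int.castRingHom (ZMod p))).toAffine.Point p
  set Np : ℚ_[p] := (Nat.card (AddCommGroup.primaryComponent
    ((integralModelInt W).map (Int.castRingHom (ZMod p))).toAffine.Point p) : ℚ_[p]) with hNp
  have hNcount : (W.reductionPointCount p : ℚ_[p]) = ((u₃ : ℤ_[p]) : ℚ_[p]) * Np := by
    rw [WeierstrassCurve.reductionPointCount, hNp]
    exact hu₃
  have hNp0 : Np ≠ 0 := by rw [hNp]; exact_mod_cast Nat.card_pos.ne'
  have h1 : (1 - a⁻¹) = ((u₂ : ℤ_[p]) : ℚ_[p]) * ((u₃ : ℤ_[p]) : ℚ_[p]) * Np := by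
    rw [hu₂, hNcount, mul_assoc]
  have h1ne : (1 - a⁻¹) ≠ 0 := by
    rw [h1]
    exact mul_ne_zero (mul_ne_zero (coe_units_ne_zero p u₂) (coe_units_ne_zero p u₃)) hNp0
  have hg00 : constantCoeff g ≠ 0 := by
    intro h0
    rw [h0, PadicInt.coe_zero] at hg0c
    have : (ϖ : ℚ_[p]) * ((1 - a⁻¹) ^ 2 * (s : ℚ_[p])) ≠ 0 :=
      mul_ne_zero (by exact_mod_cast hϖ0) (mul_ne_zero (pow_ne_zero 2 h1ne) (by exact_mod_cast hs0))
    exact this hg0c.symm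
  have hfE00 : constantCoeff fE ≠ 0 := by
    intro h0
    apply hg00
    rw [← hgh, map_mul, h0, mul_zero]
  -- `rank E(ℚ) = 0`: `T^{rank} ∣ fE` and `fE(0) ≠ 0`
  have hr0 : W.mordellWeilRank = 0 := by
    by_contra hne
    have hdvd := W.X_pow_mordellWeilRank_dvd_of_mem_charIdeal hγ D hX
      (hchar' ▸ Ideal.mem_span_singleton_self fE)
    obtain ⟨c, hc⟩ := (dvd_pow_self (PowerSeries.X : IwasawaAlgebra p) hne).trans hdvd
    apply hfE00
    rw [hc, map_mul, PowerSeries.constantCoeff_X, zero_mul]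
  -- the typed input `ξ^t ∣ f_E` from the certificate and the p. 132 shape, then route C^t
  have hξ : Iwasawa.CyclotomicFactorPowAtTorsion W p t :=
    Iwasawa.cyclotomicFactorPowAtTorsion_of_layerRankGEAt (r := 0) (le_of_eq hr0)
      (by rw [zero_add]; exact hm)
  exact mazurMainConjecture_of_cyclotomicFactorPowTorsion_of_hb hW16 hGr h310 hp hgood hord hred hL hμan
    hμ hlam hξ hb hn κ γ hκ hγ hγ' f hf ϖ hϖ D

end Squeeze

end Summit.BirchSwinnertonDyer.Rank1Residual.X1.CyclotomicFactorPow

end
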